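import Literature.Computability.MetaComplexity.NCIPSFormulaCertificate
import Literature.Computability.MetaComplexity.Frege
import HarnessLib

/-!
# Li–Tzameret–Wang, Theorem 1.4: non-commutative IPS written as formulas polynomially simulates
# Frege — named fact

Topic `Literature/Computability/MetaComplexity`; cite item `wi-41753` (route
`PneNP/CnfIdealGenLength`, support item `FregeShortensGenLength` stmt-PneNP-18886).  Builds on
`NCIPSFormulaCertificate.lean` (`NCIPS.HasFormulaCertificateOfTaut R s T`: an NC-IPS certificate of
`tr(¬T)` from the Boolean and commutator axioms, written as a non-commutative formula of size `≤ s`)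
and on the tree's Frege systems (`Frege.lean`: `FregeSystem`, `IsFrege`, `FregeSystem.IsProofOf`,
`proofSize` = total symbol count).

## Source

F. Li, I. Tzameret, Z. Wang, *Characterizing propositional proofs as noncommutative formulas*,
SIAM J. Comput. 47 (2018) = arXiv:1412.8746 [LiTzameretWang2018], **Theorem 1.4** (= Theorem 1 of
the arXiv introduction, p. 5): "Let 𝔽 be either `ℚ` or `ℤ_q`, for a prime `q`. The non-commutative
IPS refutation system, when refutations are written as non-commutative formulas over 𝔽,
polynomially simulates the Frege system. More precisely, for every propositional tautology `T`, if
`T` has a polynomial-size Frege proof then there is a non-commutative IPS certificate (over 𝔽) of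
`tr(¬T)` that has a polynomial non-commutative formula size."  §2.1: "We do not need to work with
a specific Frege proof system, since … every two Frege proof systems, even over different
languages, are polynomially equivalent [Reckhow 1976]"; the size of a Frege proof is "the total
sizes of all the Boolean formulas in the proof" (Def. 2.3 / arXiv Def. 7).  Proof: §3–§4 (Frege is
p-simulated by Grigoriev–Hirsch's tree-like `𝓕-PC`, which NC-IPS simulates line by line).

## Rendering

"Polynomially simulates": for every Frege system `F` (the tree's `IsFrege F`: finitely many sound
schematic rules over `PropForm ℕ`, implicationally complete — Cook–Reckhow's notion, the one the
paper uses) there is a polynomial `q` such that every `F`-proof `π` of `T` yields a certificate of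
`tr(¬T)` of formula size `≤ q(proofSize π)`; over `ℚ`, and over `ZMod p` for every prime `p`.
`tr` is the directory's rendering of LTW's Def. 1.3 in the convention `1 = true`
(`NCIPSFormulaCertificate.lean`): it differs from the printed `tr` by the involution
`x_i ↦ 1 − x_i`, which maps certificates to certificates (the axiom set is stable up to sign) and
changes formula sizes by a constant factor, so the polynomial-size statement is the printed one.
Statement only; the converse quasi-polynomial simulation (Thm. 1.7) is not vendored.
-/

noncomputable section

namespace Literature.Computability.MetaComplexity

open Literature.Computability.Complexity

/-- **Li–Tzameret–Wang 2018, Theorem 1.4** (non-commutative formula IPS polynomially simulates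
Frege): for every Frege system `F` there is a polynomial `q` such that whenever `π` is an
`F`-proof of a propositional formula `T`, the hypothesis `tr(¬T)` has a non-commutative IPS
certificate from the Boolean and commutator axioms written as a non-commutative formula of size at
most `q(|π|)` (`|π| = proofSize π`, the total symbol count) — over `ℚ`, and likewise over `ZMod p`
for every prime `p`.  Rendering: module docstring.  Statement only; users take
`(h : LiTzameretWang2018_thm14)`.
[cite: LiTzameretWang2018, Thm. 1.4 (arXiv Thm. 1, p. 5) with §2.1 (any Frege system) and Def. 2.3 (proof size)] -/
def LiTzameretWang2018_thm14 : Prop :=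
  ∀ F : FregeSystem, IsFrege F →
    (∃ q : Polynomial ℕ, ∀ (T : PropForm ℕ) (π : List (PropForm ℕ)), F.IsProofOf π T →
        NCIPS.HasFormulaCertificateOfTaut ℚ (q.eval (proofSize π)) T) ∧
    ∀ p : ℕ, p.Prime → ∃ q : Polynomial ℕ, ∀ (T : PropForm ℕ) (π : List (PropForm ℕ)),
        F.IsProofOf π T → NCIPS.HasFormulaCertificateOfTaut (ZMod p) (q.eval (proofSize π)) T

/-- The consequence used by route `PneNP/CnfIdealGenLength`: over `ℚ`, a Frege system `F` admits
a polynomial `q` turning every `F`-proof of size `s` of `¬φ̂` (`φ̂ = PropForm.ofCNF φ`, `φ` an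
unsatisfiable CNF) into an NC-IPS formula certificate of `tr(¬¬φ̂)` of size `≤ q(s)` — the
instance `T = ¬ ofCNF φ` of the fact. [cite: LiTzameretWang2018, Thm. 1.4 (instance T = ¬φ for a CNF φ)] -/
theorem LiTzameretWang2018_thm14.cnf (h : LiTzameretWang2018_thm14) {F : FregeSystem}
    (hF : IsFrege F) :
    ∃ q : Polynomial ℕ, ∀ (φ : CNF ℕ) (π : List (PropForm ℕ)),
      F.IsProofOf π (PropForm.neg (PropForm.ofCNF φ)) →
        NCIPS.HasFormulaCertificateOfTaut ℚ (q.eval (proofSize π))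
          (PropForm.neg (PropForm.ofCNF φ)) := by
  obtain ⟨⟨q, hq⟩, -⟩ := h F hF
  exact ⟨q, fun φ π hπ => hq _ π hπ⟩

end Literature.Computability.MetaComplexity

end
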